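import Summits.Ventures.Crystal3D.Theorems.StickyWulffConstantGenericWallFloorHRowWalk
import Summits.Ventures.Crystal3D.Theorems.StickyWulffConstantGenericWallFloorExactOnlyTransport
import HarnessLib

/-!
# E1h in MODEL FORM and its transport to every frame, centre and in-plane direction (`HStarCertifiedAt`)
# (crux `GenericWallFloor`, stmt-Ventures-19480, kernel G; line «LAYER ROWS» of cf-p1 (ccix)/(ccx), item (R2)(k2) interface; 19480-p2 g13)

HONEST FRAMING. Venture `Summits/Ventures/Crystal3D` (cell `crystal3d-full`), route `route-Ventures-StickyWulffConstant`, helper for the crux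
`GenericWallFloor` (stmt-Ventures-19480) / consumer `TextureLiminfV5` (stmt-Ventures-23912).  One definition (a named hypothesis) + transport
bookkeeping; standard axioms; NO certificate is proved here; F-C1 not moved.

THE POINT.  The h-layer row machine (`…GenericWallFloorHRowWalk`, p715926) pays at its END through the per-run hypothesis `HStarCertifiedAt F u`:
at every centre `y`, the closed star `{y + F s : s ∈ hcpSlots, ⟪s, −u⟫ > 0}` of the in-plane arrival slot is EXACT-ONLY and SINGLE-DOZEN for the
anticuboctahedral dozen `y + F·hcpSlots`.  This file states the hypothesis ONCE, in model coordinates, and transports it: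
* `hStar u := hcpSlots.filter (0 < ⟪·, −u⟫)` — the equatorial closed star (own-5 orbit A12-583) of the in-plane slot `−u`;
* **`HStarModel`** — for each of the six in-plane slots `u₀`: `ExactOnly 0 (hStar u₀)` (E1h proper, the certified computation of (ccix)(R2)) AND
  `SingleDozen 0 hcpSlots (hStar u₀)` (the hand lemma «the equatorial closed star lies in ONE close-packed dozen» — owner's enumeration
  HOME/wall-p2-g13/LAYER-ROWS-R1-CHECK.md §1 row 2; to be discharged in the tree, at which point `HStarModel` follows from the six `ExactOnly` rows, and
  those from one by the in-plane bond mirrors);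
* **`hStarCertifiedAt_of_model : HStarModel → HStarCertifiedAt F u`** for every frame `F` and in-plane slot `u` (`ExactOnly.image`, `SingleDozen.image`
  under the rigid motion `x ↦ F x + y`);
* `hRow_end_of_model` — `hRow_end` with `HStarModel` in place of the per-run hypothesis.
WHAT THIS IS NOT: no proof of `HStarModel` (named hypothesis, E1h); not the symmetry reduction six → one; F-C1 not moved.
-/

noncomputable section

namespace Summit.Ventures.Crystal3D.Theorems

open Finset
open scoped InnerProductSpace

variable {X : Finset (EuclideanSpace ℝ (Fin 3))}

/-- **The equatorial closed star of the in-plane arrival slot `−u`** in the anticuboctahedral dozen: `−u` and its four neighbours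
(`−u ± 60°`, the upper slot adjacent to `−u`, and its basal mirror) — own-5 orbit A12-583. -/
def hStar (u : EuclideanSpace ℝ (Fin 3)) : Finset (EuclideanSpace ℝ (Fin 3)) :=
  hcpSlots.filter fun s => 0 < ⟪s, -u⟫_ℝ

/-- **E1h IN MODEL FORM** (named hypothesis of the LAYER ROWS line): for each in-plane slot `u₀` of `Λ₀`, the equatorial closed star `hStar u₀`
around the origin is EXACT-ONLY (every twelve-ball kissing completion is a close-packed dozen — the certified computation A12-583) and SINGLE-DOZEN
for `hcpSlots` (the only close-packed dozen containing it is the model anticuboctahedron — a hand lemma, to be discharged). -/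
def HStarModel : Prop :=
  ∀ u₀ ∈ fccSlots, u₀ 2 = 0 → ExactOnly 0 (hStar u₀) ∧ SingleDozen 0 hcpSlots (hStar u₀)

/-- Unfolding `hStar`. -/
theorem hStar_eq (u : EuclideanSpace ℝ (Fin 3)) : hStar u = hcpSlots.filter fun s => 0 < ⟪s, -u⟫_ℝ := rfl

/-- The image of a finset under `x ↦ F x + y` is its image under `s ↦ y + F s`. -/
theorem image_frame_add_comm (F : EuclideanSpace ℝ (Fin 3) ≃ₗᵢ[ℝ] EuclideanSpace ℝ (Fin 3)) (y : EuclideanSpace ℝ (Fin 3))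
    (S : Finset (EuclideanSpace ℝ (Fin 3))) : (S.image fun x => F x + y) = S.image fun s => y + F s :=
  Finset.image_congr fun x _ => add_comm (F x) y

/-- **TRANSPORT: the model hypothesis gives the per-run certificate for every frame and every in-plane direction.** -/
theorem hStarCertifiedAt_of_model (h : HStarModel) (F : EuclideanSpace ℝ (Fin 3) ≃ₗᵢ[ℝ] EuclideanSpace ℝ (Fin 3))
    {u : EuclideanSpace ℝ (Fin 3)} (hu : u ∈ fccSlots) (hu2 : u 2 = 0) : HStarCertifiedAt F u := by
  classical
  intro y
  obtain ⟨hE, hS⟩ := h u hu hu2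
  have e1 := hE.image F y
  have e2 := hS.image F y
  rw [map_zero, zero_add, image_frame_add_comm] at e1
  rw [map_zero, zero_add, image_frame_add_comm, image_frame_add_comm] at e2
  exact ⟨e1, e2⟩

/-- **THE END OF AN h-ROW under the model hypothesis** (`hRow_end` ∘ `hStarCertifiedAt_of_model`): with fuel `N`, `r·N > H − ⟪y, z⟫`, the run from a
state satisfying `HRowInv` stops at a ball of `X` with at most eleven contacts, `n ≤ N` steps `F u` from `y`. -/
theorem hRow_end_of_model (hX : ∀ p ∈ X, ∀ q ∈ X, p ≠ q → 1 ≤ dist p q) (hcert : HStarModel)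
    {F : EuclideanSpace ℝ (Fin 3) ≃ₗᵢ[ℝ] EuclideanSpace ℝ (Fin 3)} {u : EuclideanSpace ℝ (Fin 3)} (hu : u ∈ fccSlots) (hu2 : u 2 = 0)
    {z : EuclideanSpace ℝ (Fin 3)} {r H : ℝ} (hrise : r ≤ ⟪F u, z⟫_ℝ) (hH : ∀ p ∈ X, ⟪p, z⟫_ℝ ≤ H)
    {y : EuclideanSpace ℝ (Fin 3)} (hI : HRowInv X F u y) {N : ℕ} (hN : H - ⟪y, z⟫_ℝ < r * N) :
    ∃ n : ℕ, n ≤ N ∧ hRowRun X F u N y = y + (n : ℝ) • F u ∧ hRowRun X F u N y ∈ X ∧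
      hRowStep X F u (hRowRun X F u N y) = none ∧ (X.filter fun q => dist (hRowRun X F u N y) q = 1).card ≤ 11 :=
  hRow_end hX hu hu2 (hStarCertifiedAt_of_model hcert F hu hu2) hrise hH hI hN

end Summit.Ventures.Crystal3D.Theorems

end
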